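import Summits.BirchSwinnertonDyer.BirchSwinnertonDyer.Theses.SemiOrdinaryEisensteinDescent
import Summits.BirchSwinnertonDyer.BirchSwinnertonDyer.Theorems.SemiOrdinaryEisensteinDescentWildSigmaDivisibilityAtThreeOfFlatOfManinScaling
import Summits.BirchSwinnertonDyer.BirchSwinnertonDyer.Theorems.SemiOrdinaryEisensteinDescentWildKolyvaginUpperAtThreeTowerFree
import Literature.NumberTheory.EllipticCurves.HeegnerPointsRationalityProofs
import HarnessLib

/-!
# Route `SemiOrdinaryEisensteinDescent`, crux J′ `WildSigmaDivisibilityAtThreeTowerFree` (stmt-BirchSwinnertonDyer-24702) — and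
# through it the crux of record Ko′ `WildKolyvaginUpperAtThreeTowerFree` (stmt-24696): the MANIN SLACK ISOLATED IN THE KERNEL,
# TOWER-FREE — J′ ⟸ J′♭ (J′ on data with `3 ∤ c(Dt)`: Jetchev's Σ-form PROPER, onto mod `3` only) + the MANIN SCALING statement;
# Ko′ BY NAME ⟸ the same two + {Cassels–Tate level inputs, Gross 3.7 (2), GZ86 III (3.1)}
# (width seat `bsd-wall-soed-p2-w2` g5; `--supports stmt-BirchSwinnertonDyer-24702`, helper; BSD is not proved by any of this)

WHY. Since SOED rev 12–15 (pen pss3x g2, act F) the deciding chain binds the TOWER-FREE Kolyvagin–McCallum upper bound Ko′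
(stmt-24696; crux 20480 Ko with the `3`-adic tower binder deleted) whose research child is J′ (stmt-24702; = J 20760 minus the
tower binder): the Σ-form `3`-power divisibility of the derived Heegner points `P(n)` for every depth
`s′ ≤ ord₃ ∏ c_q(E) + v₃ c(Dt)` — «Manin-robust»: the slack `v₃ c(Dt)` is the `3`-part of the Manin constant of the datum. Lead
soed-p2 g2 (memo `Cruxes/WildKolyvaginUpperAtThree/MANIN-SHADOW-lead-g2.md`, kernel p583762
`WildSigmaDivisibilityAtThreeOfFlatOfManinScaling`) showed for the TOWER version J that this slack is not harmless on the Euler-system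
road and isolated it: J ⟸ J♭ ∧ ManinScaling₃ by DATUM SCALING. This file is the same statement for the crux of record: the tower
binder `AdditiveThree.TowerSurjThree W` is simply absent from both the hypothesis J′♭ and the conclusion J′ (it was passed through,
never used, in p583762 §4), and Ko′ follows by w2 g3's tower-free receptacle
`WildKolyvaginUpperAtThreeTowerFree.koTowerFree_of_sigmaTowerFree_of_threePrimitives` (p594241) instead of the Kolyvagin-Thm-A road.
So the open content of the SOED Ko′-column reads, in the kernel: (J′♭ = Jetchev 2008 Conj. 1.3 Σ-form at the additive prime `3`, onto
mod `3`, NO Manin term — beyond the max-form this is Büyükboduk 2009 §4.2 Question 1) ⊕ (ManinScaling₃ = «every parametrisation datum of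
a curve of the cell is an integer multiple of one with `3 ∤ c`» ⟺ `3 ∤ c_opt` at `27 ∣ N`, the `3`-part of Manin's conjecture, off print
on the row: Česnavičius–Neururer–Saha need `3 ∤ deg φ₀`).

WHAT IS PROVED (no definition, no named fact, no `sorry`; CONDITIONAL on the displayed hypotheses, nothing asserted about any curve):
* `wildSigmaDivisibilityAtThreeTowerFree_of_flat_of_maninScaling : J′♭ → ManinScaling₃ → J′` — J′ BY NAME; J′♭ is J′'s text
  VERBATIM with ONE extra binder `¬ (3 : ℤ) ∣ Dt.c`; ManinScaling₃ exactly as in p583762 (`∃ Dt′ k, Dt′.f = Dt.f ∧ Dt′.uniformize =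
  Dt.uniformize ∧ Dt.c = k * Dt′.c ∧ ¬ 3 ∣ Dt′.c` under the curve-level binders). Proof = p583762 §4 verbatim minus the tower
  binder: the scaling lemmas `heegnerPointComplex_eq_zsmul_of_scaling`, `exists_scaled_kolyvaginHeegnerData` (CM inputs = Darmon
  Thm. 3.6 PROVED in the tree) and the depth bookkeeping `s′ ≤ ord₃ ∏ c_ℓ + v₃(k c′) = ord₃ ∏ c_ℓ + v₃ k`.
* `koTowerFree_of_flat_of_maninScaling_of_threePrimitives` — Ko′'s displayed text ⟸ {CT, 3.7 (2), E0} + J′♭ + ManinScaling₃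
  (∘ p594241 §3), and `wildKolyvaginUpperAtThreeTowerFree_of_flat_of_maninScaling_of_threePrimitives` — the crux Ko′ BY NAME.
* `wildSigmaDivisibilityAtThree_of_flatTowerFree_of_maninScaling` — the aside J (20760, tower version) from the SAME two
  hypotheses (J′♭ is weaker to assume than J♭: one `fun` discards the tower binder), so one pair of inputs serves both lineages.
References: [Jetchev2008] Rem. 1.2, Conj. 1.3 (p. 812); [McCallumLMS1991] §3, §5 Cor. 5.6 (p. 310); [Cha2005] Thm. 3/7 (mod-`ℓ`
image suffices); [CesnaviciusNeururerSaha2023] Thm. 1.2; [Darmon2004] Thm. 3.6; [Buyukboduk2009] §4.2 Q1.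
-/

set_option autoImplicit false
set_option linter.dupNamespace false -- `Summit.BirchSwinnertonDyer.BirchSwinnertonDyer.…` is the tree's layout (D-0017)

noncomputable section

open scoped Classical

namespace Summit.BirchSwinnertonDyer.BirchSwinnertonDyer.Theorems.WildSigmaDivisibilityAtThreeTowerFreeOfFlatOfManinScaling

open WeierstrassCurve NumberField Literature.NumberTheory.EllipticCurves
  Literature.NumberTheory.EllipticCurves.ModularForms
  Summit.BirchSwinnertonDyer.Rank1Residual
  Summit.BirchSwinnertonDyer.Rank1Residual.Additive
  Summit.BirchSwinnertonDyer.Rank1Residual.X11b.Three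
  Summit.BirchSwinnertonDyer.BirchSwinnertonDyer.Theses.SemiOrdinaryEisensteinDescent
  Summit.BirchSwinnertonDyer.BirchSwinnertonDyer.Theorems.WildSigmaDivisibilityAtThreeOfFlatOfManinScaling

/-! ## §1 J′ ⟸ J′♭ + Manin scaling (tower-free) -/

/-- **J′ `WildSigmaDivisibilityAtThreeTowerFree` (stmt-24702) BY NAME ⟸ J′♭ (J′ on data with `3 ∤ c(Dt)`) + ManinScaling₃.**
`hFlat` is J′'s text VERBATIM with ONE extra binder `¬ (3 : ℤ) ∣ Dt.c` (so its depth is `ord₃ ∏ c_ℓ` only: Jetchev's Conj. 1.3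
Σ-form at the additive prime `3` under `ρ̄₃` onto, NO tower, NO Manin content); `hScal` says that every datum of a curve of the cell
is, analytically, an integer multiple `c = k·c′` of a datum with `3 ∤ c′` (⟺ `3 ∤ c_opt` at `27 ∣ N` — a displayed hypothesis, NOT
proved here). Proof: datum scaling exactly as in p583762 §4 (`heegnerPointComplex_eq_zsmul_of_scaling`,
`exists_scaled_kolyvaginHeegnerData`; the `K`-rationality of `y_K(Dt′)` is Darmon Thm. 3.6 PROVED,
`heegnerPointComplex_mem_range_map_holds`): `P = k·P′`, `P(n) = k·P′(n)`, and at depth `s′ ≤ ord₃ ∏ c_ℓ + v₃ k` either `3^{s′} ∣ k`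
(free) or J′♭ at depth `s′ − v₃ k` on the companion datum. CONDITIONAL on both hypotheses; J′, Ko′, Manin's conjecture and BSD stay
open. [cite: Jetchev2008, Rem. 1.2 and Conj. 1.3 (p. 812)] [cite: CesnaviciusNeururerSaha2023, Thm. 1.2] [cite: Darmon2004, Thm. 3.6] -/
theorem wildSigmaDivisibilityAtThreeTowerFree_of_flat_of_maninScaling
    (hFlat : ∀ (W : WeierstrassCurve ℚ) [W.IsElliptic] [W.IsGloballyMinimal] (N : ℕ) [NeZero N] (K : Type)
      [Field K] [NumberField K] (Dt : ModularParametrizationData W N)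
      (H : HeegnerDatum N (NumberField.discr K)) (ι : K →+* ℂ) (P : (W.baseChange K).toAffine.Point),
      ClassO6 W 3 → W.HasSurjectiveModNGaloisRep 3 → W.analyticRank = 1 → W.conductorNorm ℤ = N →
      IsImaginaryQuadratic K → SatisfiesHeegnerHypothesis N K →
      (W.quadraticTwist (NumberField.discr K : ℚ)).entireLFunction 1 ≠ 0 →
      WeierstrassCurve.Affine.Point.map ι.toRatAlgHom P = heegnerPointComplex Dt H →
      ¬ IsOfFinAddOrder P → Odd (NumberField.discr K) → NumberField.discr K ≠ -3 →
      ¬ (3 : ℤ) ∣ Dt.c →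
      ∀ (s' : ℕ), s' ≤ padicValNat 3 W.tamagawaProduct + padicValNat 3 Dt.c.natAbs →
        ∀ (n : ℕ) (d : KolyvaginHeegnerData Dt H.β ι n), Squarefree n →
          (∀ ℓ ∈ n.primeFactors, Zhang2014.IsKolyvaginPrime N W K 3 ℓ ∧
            s' ≤ Zhang2014.kolyvaginIndex W 3 ℓ) → Koly.PDiv d 3 s')
    (hScal : ∀ (W : WeierstrassCurve ℚ) [W.IsElliptic] [W.IsGloballyMinimal] (N : ℕ) [NeZero N],
      ClassO6 W 3 → W.HasSurjectiveModNGaloisRep 3 → W.analyticRank = 1 → W.conductorNorm ℤ = N →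
      ∀ (Dt : ModularParametrizationData W N), ∃ (Dt' : ModularParametrizationData W N) (k : ℤ),
        Dt'.f = Dt.f ∧ Dt'.uniformize = Dt.uniformize ∧ Dt.c = k * Dt'.c ∧ ¬ (3 : ℤ) ∣ Dt'.c) :
    WildSigmaDivisibilityAtThreeTowerFree := by
  intro W _ _ N _ K _ _ Dt H ι P hO6 hsurj hr hN hK hHH hL hP hnt hodd h3 s' hs' n d hn hℓ
  haveI : Fact (Nat.Prime 3) := ⟨Nat.prime_three⟩
  obtain ⟨Dt', k, hf, hu, hc, hc'⟩ := hScal W N hO6 hsurj hr hN Dt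
  -- the `K`-rational Heegner point of `Dt′` (Darmon Thm. 3.6, PROVED) and `P = k·P′`
  obtain ⟨P', hP'⟩ := heegnerPointComplex_mem_range_map_holds N W K hK hHH Dt' H ι
  have hPk : P = k • P' := by
    apply WeierstrassCurve.Affine.Point.map_injective (W' := W) ι.toRatAlgHom
    rw [map_zsmul, hP, hP', heegnerPointComplex_eq_zsmul_of_scaling hf hu hc]
  have hnt' : ¬ IsOfFinAddOrder P' := fun h ↦ hnt (hPk ▸ h.zsmul)
  have hk0 : k ≠ 0 := by
    rintro rfl
    exact hnt (by rw [hPk, zero_smul]; exact IsOfFinAddOrder.zero)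
  -- `v₃(c(Dt)) = v₃(k)`
  set v := padicValNat 3 k.natAbs with hv
  have hc'0 : Dt'.c ≠ 0 := by rintro h; exact hc' (h ▸ dvd_zero 3)
  have hvc : padicValNat 3 Dt.c.natAbs = v := by
    rw [hc, Int.natAbs_mul, padicValNat.mul (Int.natAbs_ne_zero.mpr hk0) (Int.natAbs_ne_zero.mpr hc'0),
      padicValNat.eq_zero_of_not_dvd (fun h ↦ hc' (Int.natCast_dvd.mpr h)), add_zero]
  -- `3^v ∣ k`
  obtain ⟨m, hm⟩ : ((3 ^ v : ℕ) : ℤ) ∣ k := Int.natCast_dvd.mpr pow_padicValNat_dvd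
  -- the companion datum `d′` with `P(n) = k·P′(n)`
  have hn0 : n ≠ 0 := hn.ne_zero
  have hcop : Nat.Coprime n N := Nat.coprime_of_dvd fun q hq hqn hqN ↦
    (hℓ q (Nat.mem_primeFactors.mpr ⟨hq, hqn, hn0⟩)).1.2.1 hqN
  obtain ⟨d', hd'⟩ := exists_scaled_kolyvaginHeegnerData hK hHH hf hu hc hn0 hcop d
  by_cases hsv : s' ≤ v
  · -- free: `3^{s′} ∣ k`
    obtain ⟨m', hm'⟩ : ((3 ^ s' : ℕ) : ℤ) ∣ k :=
      (Int.natCast_dvd_natCast.mpr (pow_dvd_pow 3 hsv)).trans ⟨m, hm⟩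
    exact ⟨m' • d'.derivedPoint, by rw [← mul_smul, ← hm', hd']⟩
  · -- J′♭ at depth `s′ − v ≤ ord₃ ∏ c_ℓ` on `d′`
    push Not at hsv
    have hb : s' - v ≤ padicValNat 3 W.tamagawaProduct + padicValNat 3 Dt'.c.natAbs := by omega
    have hℓ' : ∀ ℓ ∈ n.primeFactors, Zhang2014.IsKolyvaginPrime N W K 3 ℓ ∧
        s' - v ≤ Zhang2014.kolyvaginIndex W 3 ℓ := fun ℓ hℓn ↦
      ⟨(hℓ ℓ hℓn).1, le_trans (Nat.sub_le _ _) (hℓ ℓ hℓn).2⟩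
    obtain ⟨Q', hQ'⟩ := hFlat W N K Dt' H ι P' hO6 hsurj hr hN hK hHH hL hP' hnt' hodd h3 hc' (s' - v) hb
      n d' hn hℓ'
    refine ⟨m • Q', ?_⟩
    have hpow : ((3 ^ s' : ℕ) : ℤ) * m = k * ((3 ^ (s' - v) : ℕ) : ℤ) := by
      have h3 : (3 : ℤ) ^ s' = 3 ^ v * 3 ^ (s' - v) := by
        rw [← pow_add, Nat.add_sub_cancel' hsv.le]
      rw [hm]; push_cast
      rw [h3]; ring
    rw [← mul_smul, hpow, mul_smul, hQ', hd']

/-- **The aside J `WildSigmaDivisibilityAtThree` (stmt-20760, tower version) from the SAME two tower-free hypotheses** — the tower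
binder of J is discarded (`fun`), so the pair (J′♭, ManinScaling₃) serves both the crux of record and the banked aside; compare
p583762 §4, whose `hFlat` carried the tower binder. CONDITIONAL; nothing about any curve is asserted. [cite: Jetchev2008, Conj. 1.3 (p. 812)] -/
theorem wildSigmaDivisibilityAtThree_of_flatTowerFree_of_maninScaling
    (hFlat : ∀ (W : WeierstrassCurve ℚ) [W.IsElliptic] [W.IsGloballyMinimal] (N : ℕ) [NeZero N] (K : Type)
      [Field K] [NumberField K] (Dt : ModularParametrizationData W N)
      (H : HeegnerDatum N (NumberField.discr K)) (ι : K →+* ℂ) (P : (W.baseChange K).toAffine.Point),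
      ClassO6 W 3 → W.HasSurjectiveModNGaloisRep 3 → W.analyticRank = 1 → W.conductorNorm ℤ = N →
      IsImaginaryQuadratic K → SatisfiesHeegnerHypothesis N K →
      (W.quadraticTwist (NumberField.discr K : ℚ)).entireLFunction 1 ≠ 0 →
      WeierstrassCurve.Affine.Point.map ι.toRatAlgHom P = heegnerPointComplex Dt H →
      ¬ IsOfFinAddOrder P → Odd (NumberField.discr K) → NumberField.discr K ≠ -3 →
      ¬ (3 : ℤ) ∣ Dt.c →
      ∀ (s' : ℕ), s' ≤ padicValNat 3 W.tamagawaProduct + padicValNat 3 Dt.c.natAbs →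
        ∀ (n : ℕ) (d : KolyvaginHeegnerData Dt H.β ι n), Squarefree n →
          (∀ ℓ ∈ n.primeFactors, Zhang2014.IsKolyvaginPrime N W K 3 ℓ ∧
            s' ≤ Zhang2014.kolyvaginIndex W 3 ℓ) → Koly.PDiv d 3 s')
    (hScal : ∀ (W : WeierstrassCurve ℚ) [W.IsElliptic] [W.IsGloballyMinimal] (N : ℕ) [NeZero N],
      ClassO6 W 3 → W.HasSurjectiveModNGaloisRep 3 → W.analyticRank = 1 → W.conductorNorm ℤ = N →
      ∀ (Dt : ModularParametrizationData W N), ∃ (Dt' : ModularParametrizationData W N) (k : ℤ),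
        Dt'.f = Dt.f ∧ Dt'.uniformize = Dt.uniformize ∧ Dt.c = k * Dt'.c ∧ ¬ (3 : ℤ) ∣ Dt'.c) :
    WildSigmaDivisibilityAtThree := by
  intro W _ _ N _ K _ _ Dt H ι P hO6 hsurj hr hN hK hHH hL hP hnt hodd h3 _htower
  exact wildSigmaDivisibilityAtThreeTowerFree_of_flat_of_maninScaling hFlat hScal W N K Dt H ι P hO6 hsurj hr hN
    hK hHH hL hP hnt hodd h3

/-! ## §2 Ko′ ⟸ J′♭ + Manin scaling + the three McCallum-road primitives -/

/-- **Ko′'s displayed text ⟸ {`∀ K, casselsTate_levelInputs K`, Gross 1991 Prop. 3.7 (2), GZ86 III (3.1)} + J′♭ + ManinScaling₃** —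
§1 composed with w2 g3's tower-free receptacle `WildKolyvaginUpperAtThreeTowerFree.koTowerFree_of_sigmaTowerFree_of_threePrimitives`
(p594241: McCallum's Cor. 5.6, upper half, DERIVED in the kernel from the three primitives under `ρ̄₃` onto only). The conclusion is
the crux Ko′ unfolded (displayed), for consumers that import neither route file. CONDITIONAL on all five displayed hypotheses.
[cite: McCallumLMS1991, §5 Cor. 5.6 (p. 310)] [cite: Jetchev2008, Conj. 1.3 (p. 812)] [cite: GrossLMS1991, §3 Prop. 3.7 (2), §6] -/
theorem koTowerFree_of_flat_of_maninScaling_of_threePrimitives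
    (hCT : ∀ (K : Type) [Field K] [NumberField K], casselsTate_levelInputs K)
    (h372 : GrossLMS1991.prop37_2_frobeniusCongruence)
    (hE0 : Gross1991_heegnerPoint_sub_ratTorsion_mem_E0)
    (hFlat : ∀ (W : WeierstrassCurve ℚ) [W.IsElliptic] [W.IsGloballyMinimal] (N : ℕ) [NeZero N] (K : Type)
      [Field K] [NumberField K] (Dt : ModularParametrizationData W N)
      (H : HeegnerDatum N (NumberField.discr K)) (ι : K →+* ℂ) (P : (W.baseChange K).toAffine.Point),
      ClassO6 W 3 → W.HasSurjectiveModNGaloisRep 3 → W.analyticRank = 1 → W.conductorNorm ℤ = N →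
      IsImaginaryQuadratic K → SatisfiesHeegnerHypothesis N K →
      (W.quadraticTwist (NumberField.discr K : ℚ)).entireLFunction 1 ≠ 0 →
      WeierstrassCurve.Affine.Point.map ι.toRatAlgHom P = heegnerPointComplex Dt H →
      ¬ IsOfFinAddOrder P → Odd (NumberField.discr K) → NumberField.discr K ≠ -3 →
      ¬ (3 : ℤ) ∣ Dt.c →
      ∀ (s' : ℕ), s' ≤ padicValNat 3 W.tamagawaProduct + padicValNat 3 Dt.c.natAbs →
        ∀ (n : ℕ) (d : KolyvaginHeegnerData Dt H.β ι n), Squarefree n →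
          (∀ ℓ ∈ n.primeFactors, Zhang2014.IsKolyvaginPrime N W K 3 ℓ ∧
            s' ≤ Zhang2014.kolyvaginIndex W 3 ℓ) → Koly.PDiv d 3 s')
    (hScal : ∀ (W : WeierstrassCurve ℚ) [W.IsElliptic] [W.IsGloballyMinimal] (N : ℕ) [NeZero N],
      ClassO6 W 3 → W.HasSurjectiveModNGaloisRep 3 → W.analyticRank = 1 → W.conductorNorm ℤ = N →
      ∀ (Dt : ModularParametrizationData W N), ∃ (Dt' : ModularParametrizationData W N) (k : ℤ),
        Dt'.f = Dt.f ∧ Dt'.uniformize = Dt.uniformize ∧ Dt.c = k * Dt'.c ∧ ¬ (3 : ℤ) ∣ Dt'.c) :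
    ∀ (W : WeierstrassCurve ℚ) [W.IsElliptic] [W.IsGloballyMinimal] (N : ℕ) [NeZero N] (K : Type)
      [Field K] [NumberField K] (Dt : ModularParametrizationData W N)
      (H : HeegnerDatum N (NumberField.discr K)) (ι : K →+* ℂ) (P : (W.baseChange K).toAffine.Point),
      ClassO6 W 3 → W.HasSurjectiveModNGaloisRep 3 → W.analyticRank = 1 → W.conductorNorm ℤ = N →
      IsImaginaryQuadratic K → SatisfiesHeegnerHypothesis N K →
      (W.quadraticTwist (NumberField.discr K : ℚ)).entireLFunction 1 ≠ 0 →
      WeierstrassCurve.Affine.Point.map ι.toRatAlgHom P = heegnerPointComplex Dt H →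
      ¬ IsOfFinAddOrder P → Odd (NumberField.discr K) → NumberField.discr K ≠ -3 →
      SchneiderFree.Upper.IndexUpperBoundLeAt W 3 K P (padicValNat 3 Dt.c.natAbs) :=
  WildKolyvaginUpperAtThreeTowerFree.koTowerFree_of_sigmaTowerFree_of_threePrimitives hCT h372 hE0
    (wildSigmaDivisibilityAtThreeTowerFree_of_flat_of_maninScaling hFlat hScal)

/-- **Crux of record Ko′ `WildKolyvaginUpperAtThreeTowerFree` (stmt-24696) BY NAME ⟸ {CT, 3.7 (2), E0} + J′♭ + ManinScaling₃.**
This is line `birth` v5 (pen-staged: `stub_sigma := J′`, `stub_inputsPrim := CT ∧ 3.7(2) ∧ E0`) with its research stub SPLIT into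
Jetchev's Σ-form proper off the tower (`hFlat`) and the Manin₃ scaling statement (`hScal`). CONDITIONAL on all five displayed
hypotheses; Ko′, J′, Manin's conjecture and BSD stay open. [cite: McCallumLMS1991, §5 Cor. 5.6 (p. 310)]
[cite: Jetchev2008, Conj. 1.3 (p. 812)] [cite: CesnaviciusNeururerSaha2023, Thm. 1.2] -/
theorem wildKolyvaginUpperAtThreeTowerFree_of_flat_of_maninScaling_of_threePrimitives
    (hCT : ∀ (K : Type) [Field K] [NumberField K], casselsTate_levelInputs K)
    (h372 : GrossLMS1991.prop37_2_frobeniusCongruence)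
    (hE0 : Gross1991_heegnerPoint_sub_ratTorsion_mem_E0)
    (hFlat : ∀ (W : WeierstrassCurve ℚ) [W.IsElliptic] [W.IsGloballyMinimal] (N : ℕ) [NeZero N] (K : Type)
      [Field K] [NumberField K] (Dt : ModularParametrizationData W N)
      (H : HeegnerDatum N (NumberField.discr K)) (ι : K →+* ℂ) (P : (W.baseChange K).toAffine.Point),
      ClassO6 W 3 → W.HasSurjectiveModNGaloisRep 3 → W.analyticRank = 1 → W.conductorNorm ℤ = N →
      IsImaginaryQuadratic K → SatisfiesHeegnerHypothesis N K →
      (W.quadraticTwist (NumberField.discr K : ℚ)).entireLFunction 1 ≠ 0 →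
      WeierstrassCurve.Affine.Point.map ι.toRatAlgHom P = heegnerPointComplex Dt H →
      ¬ IsOfFinAddOrder P → Odd (NumberField.discr K) → NumberField.discr K ≠ -3 →
      ¬ (3 : ℤ) ∣ Dt.c →
      ∀ (s' : ℕ), s' ≤ padicValNat 3 W.tamagawaProduct + padicValNat 3 Dt.c.natAbs →
        ∀ (n : ℕ) (d : KolyvaginHeegnerData Dt H.β ι n), Squarefree n →
          (∀ ℓ ∈ n.primeFactors, Zhang2014.IsKolyvaginPrime N W K 3 ℓ ∧
            s' ≤ Zhang2014.kolyvaginIndex W 3 ℓ) → Koly.PDiv d 3 s')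
    (hScal : ∀ (W : WeierstrassCurve ℚ) [W.IsElliptic] [W.IsGloballyMinimal] (N : ℕ) [NeZero N],
      ClassO6 W 3 → W.HasSurjectiveModNGaloisRep 3 → W.analyticRank = 1 → W.conductorNorm ℤ = N →
      ∀ (Dt : ModularParametrizationData W N), ∃ (Dt' : ModularParametrizationData W N) (k : ℤ),
        Dt'.f = Dt.f ∧ Dt'.uniformize = Dt.uniformize ∧ Dt.c = k * Dt'.c ∧ ¬ (3 : ℤ) ∣ Dt'.c) :
    WildKolyvaginUpperAtThreeTowerFree :=
  koTowerFree_of_flat_of_maninScaling_of_threePrimitives hCT h372 hE0 hFlat hScal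

end Summit.BirchSwinnertonDyer.BirchSwinnertonDyer.Theorems.WildSigmaDivisibilityAtThreeTowerFreeOfFlatOfManinScaling

end
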